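import Mathlib.MeasureTheory.Integral.Prod
import Mathlib.MeasureTheory.Group.Integral
import Mathlib.MeasureTheory.Function.LocallyIntegrable
import Literature.MeasureTheory.Group.CharacterIntegralsSeparate   -- ★ F3 `eq_of_forall_integral_char_mul_eq` (LH10-p02 (g2))
import HarnessLib

/-!
# Fourier uniqueness for CONTINUOUS compactly supported functions on an abelian group with small compact open subgroups

Topic `MeasureTheory/Group`; namespace `Literature.MeasureTheory.Group`.  THEOREMS ONLY (no definition, no instance, no notation, no named fact, no `sorry`).
Cell `pub/hodgecm-mathlib`, crux H413 = `stmt-HodgeConjecture-24833` (`--supports` lane), E1 row 47e (R-e DATUM «non-elliptic vanishing of `f_EP`»), brick E1 of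
`F0/P3b/LH6-p04/g11/r47e/CENSUS-R47E.v1.LH6p04g11.md` (door 2 (i)); seat LH6-p04 (g11).

★ F3 `eq_of_forall_integral_char_mul_eq` separates `C`-INVARIANT compactly supported functions by their integrals against the unitary locally constant characters
trivial on one compact open subgroup `C`.  Here the invariance hypothesis is replaced by CONTINUITY, at the price of testing against the characters trivial on
every small `C`: if `T` (Hausdorff, second countable) has a neighbourhood basis of `1` consisting of compact open subgroups (`hbasis`, e.g. the points of a torus over a non-archimedean local
field), `μ` is left invariant, finite on compacta, positive on opens and s-finite, and `Ψ : T → ℂ` is continuous with compact support with `∫ χ·Ψ dμ = 0` for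
every continuous locally constant unitary `χ : T →* ℂˣ`, then `Ψ = 0` (`eq_zero_of_continuous_of_forall_integral_char_mul_eq_zero`).
Proof: the `C`-average `Ψ_C(t) = ∫_C Ψ(tc) dμ(c)` is `C`-invariant (`setIntegral_comp_mul_mul_eq`), compactly supported
(`hasCompactSupport_setIntegral_comp_mul`) and still killed by every such `χ` trivial on `C` (Fubini + invariance, `integral_char_mul_setIntegral_comp_mul_eq_zero`),
so F3 gives `Ψ_C = 0`; letting `C` shrink inside a neighbourhood on which `Ψ(t₀ ·)` varies by less than `‖Ψ t₀‖∕2` forces `Ψ t₀ = 0`.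
This is the uniqueness half of Fourier inversion on `T` for `C_c(T)` [HewittRoss1979, Thm. (23.11), (22.17); (31.5)], in the form used for the torus `T ⊂ U(3)(L⁺_v)`:
van Dijk's formula `tr i_G(χ)(f) = c ∫_T χ Ψ_f dμ_T` with `Ψ_f` the (continuous, compactly supported) constant term, and `tr i_G(χ)(f) = 0` for all `χ` ⇒ `Ψ_f = 0`
[Rogawski1990, §12.7 p. 193].  HONEST LABEL: generic measure theory; HC_CM is proved only modulo the 7 printed citations (2 remaining: hLiu418 = stmt-HodgeConjecture-24832,
h413 = stmt-HodgeConjecture-24833) until rung 0 closes; this file pays no letter by itself.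

## References
* [HewittRoss1979] E. Hewitt, K. A. Ross, *Abstract Harmonic Analysis I* (2nd ed., 1979), Thm. (22.17), Thm. (23.11); vol. II Thm. (31.5).
* [Rogawski1990] J. D. Rogawski, *Automorphic Representations of Unitary Groups in Three Variables* (1990), §12.7 p. 193.
-/

set_option autoImplicit false

noncomputable section

open MeasureTheory MeasureTheory.Measure Topology Set Filter
open scoped Pointwise

namespace Literature.MeasureTheory.Group

section ContinuousUniq

variable {T : Type*} [CommGroup T] [TopologicalSpace T] [IsTopologicalGroup T] [MeasurableSpace T] [BorelSpace T]

/-- The `C`-average `t ↦ ∫_C Ψ(tc) dμ(c)` is invariant under right translation by `C` when `μ` is left invariant: `∫_C Ψ(t c₀ c) dμ(c) = ∫_C Ψ(t c) dμ(c)` for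
`c₀ ∈ C` (substitute `c ↦ c₀c`, which preserves `μ` and `C`). [cite: HewittRoss1979, Thm. (15.18)] -/
theorem setIntegral_comp_mul_mul_eq (μ : Measure T) [μ.IsMulLeftInvariant] (C : Subgroup T) (hCm : MeasurableSet (C : Set T))
    (Ψ : T → ℂ) (t : T) {c₀ : T} (hc₀ : c₀ ∈ C) :
    ∫ c in (C : Set T), Ψ (t * c₀ * c) ∂μ = ∫ c in (C : Set T), Ψ (t * c) ∂μ := by
  rw [← integral_indicator hCm, ← integral_indicator hCm]
  have hfun : (fun c => (C : Set T).indicator (fun c => Ψ (t * c₀ * c)) c) =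
      fun c => (C : Set T).indicator (fun c => Ψ (t * c)) (c₀ * c) := by
    funext c
    by_cases hc : c ∈ (C : Set T)
    · have hc' : c₀ * c ∈ (C : Set T) := C.mul_mem hc₀ hc
      rw [indicator_of_mem hc, indicator_of_mem hc', mul_assoc]
    · have hc' : c₀ * c ∉ (C : Set T) := fun h => hc (by simpa using C.mul_mem (C.inv_mem hc₀) h)
      rw [indicator_of_notMem hc, indicator_of_notMem hc']
  rw [hfun, integral_mul_left_eq_self]

omit [IsTopologicalGroup T] [BorelSpace T] in
/-- The `C`-average vanishes off the compact set `tsupport Ψ · C⁻¹`. [cite: HewittRoss1979, Thm. (15.18)] -/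
theorem setIntegral_comp_mul_eq_zero_of_notMem (μ : Measure T) (C : Set T) (Ψ : T → ℂ) {t : T}
    (ht : t ∉ tsupport Ψ * C⁻¹) : ∫ c in C, Ψ (t * c) ∂μ = 0 := by
  refine setIntegral_eq_zero_of_forall_eq_zero fun c hc => ?_
  by_contra h
  exact ht (Set.mem_mul.2 ⟨t * c, subset_tsupport _ h, c⁻¹, Set.inv_mem_inv.2 hc, by simp⟩)

omit [BorelSpace T] in
/-- The `C`-average of a compactly supported function is compactly supported (`C` compact). [cite: HewittRoss1979, Thm. (15.18)] -/
theorem hasCompactSupport_setIntegral_comp_mul (μ : Measure T) {C : Set T} (hCc : IsCompact C) (Ψ : T → ℂ) (hK : HasCompactSupport Ψ) :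
    HasCompactSupport fun t => ∫ c in C, Ψ (t * c) ∂μ :=
  HasCompactSupport.intro (hK.mul hCc.inv) fun _ ht => setIntegral_comp_mul_eq_zero_of_notMem μ C Ψ ht

/-- Fubini + invariance: if `∫ χ·Ψ dμ = 0` for a continuous character `χ` trivial on the compact open subgroup `C`, then also `∫ χ·Ψ_C dμ = 0` for the `C`-average
`Ψ_C(t) = ∫_C Ψ(tc) dμ(c)` of a continuous compactly supported `Ψ` (the integrand `(t, c) ↦ 𝟙_C(c) χ(t) Ψ(tc)` is a continuous function cut off to the compact
`(tsupport Ψ · C⁻¹) × C`, so the two iterated integrals agree; the inner `t`-integral at fixed `c ∈ C` is `∫ χ(tc⁻¹)Ψ(t) dμ(t) = ∫ χ·Ψ dμ = 0` by translation invariance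
and `χ(c) = 1`). [cite: HewittRoss1979, Thm. (13.8), Thm. (15.18)] -/
theorem integral_char_mul_setIntegral_comp_mul_eq_zero [T2Space T] [SecondCountableTopology T] (μ : Measure T) [μ.IsMulLeftInvariant] [IsFiniteMeasureOnCompacts μ] [SFinite μ]
    (C : Subgroup T) (hCo : IsOpen (C : Set T)) (hCc : IsCompact (C : Set T))
    (Ψ : T → ℂ) (hΨc : Continuous Ψ) (hK : HasCompactSupport Ψ)
    (χ : T →* ℂˣ) (hχ : Continuous χ) (hχC : ∀ c ∈ C, χ c = 1)
    (h : ∫ t, ((χ t : ℂˣ) : ℂ) * Ψ t ∂μ = 0) :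
    ∫ t, ((χ t : ℂˣ) : ℂ) * (∫ c in (C : Set T), Ψ (t * c) ∂μ) ∂μ = 0 := by
  have hCm : MeasurableSet (C : Set T) := hCo.measurableSet
  -- the two-variable integrand and its continuous envelope
  set f : T → T → ℂ := fun t c => ((χ t : ℂˣ) : ℂ) * (C : Set T).indicator (fun c => Ψ (t * c)) c with hfdef
  set g : T × T → ℂ := fun p => ((χ p.1 : ℂˣ) : ℂ) * Ψ (p.1 * p.2) with hgdef
  have hg : Continuous g :=
    ((Units.continuous_val.comp hχ).comp continuous_fst).mul (hΨc.comp (continuous_fst.mul continuous_snd))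
  have hS : IsCompact ((tsupport Ψ * (C : Set T)⁻¹) ×ˢ (C : Set T)) := (hK.mul hCc.inv).prod hCc
  have hfS : Function.uncurry f = ((tsupport Ψ * (C : Set T)⁻¹) ×ˢ (C : Set T)).indicator g := by
    funext p
    rcases p with ⟨t, c⟩
    simp only [Function.uncurry_apply_pair, hfdef]
    by_cases hc : c ∈ (C : Set T)
    · by_cases ht : t ∈ tsupport Ψ * (C : Set T)⁻¹
      · rw [indicator_of_mem hc, indicator_of_mem (Set.mk_mem_prod ht hc)]
      · have hzero : Ψ (t * c) = 0 := by
          by_contra hne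
          exact ht (Set.mem_mul.2 ⟨t * c, subset_tsupport _ hne, c⁻¹, Set.inv_mem_inv.2 hc, by simp⟩)
        rw [indicator_of_mem hc, indicator_of_notMem (fun hp => ht (Set.mem_prod.1 hp).1), hzero, mul_zero]
    · rw [indicator_of_notMem hc, indicator_of_notMem (fun hp => hc (Set.mem_prod.1 hp).2), mul_zero]
  have hint : Integrable (Function.uncurry f) (μ.prod μ) := by
    rw [hfS, integrable_indicator_iff hS.isClosed.measurableSet]
    exact hg.continuousOn.integrableOn_compact hS
  -- the left-hand side as an iterated integral
  have hlhs : ∫ t, ((χ t : ℂˣ) : ℂ) * (∫ c in (C : Set T), Ψ (t * c) ∂μ) ∂μ = ∫ t, ∫ c, f t c ∂μ ∂μ := by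
    refine integral_congr_ae (Eventually.of_forall fun t => ?_)
    simp only [hfdef]
    rw [integral_const_mul, integral_indicator hCm]
  rw [hlhs, integral_integral_swap hint]
  -- the inner `t`-integral vanishes for every `c`
  refine integral_eq_zero_of_ae (Eventually.of_forall fun c => ?_)
  simp only [hfdef, Pi.zero_apply]
  by_cases hc : c ∈ (C : Set T)
  · simp only [indicator_of_mem hc]
    have hχc : ((χ c⁻¹ : ℂˣ) : ℂ) = 1 := by
      rw [map_inv, hχC c hc, inv_one, Units.val_one]
    have hsub : (fun t => ((χ t : ℂˣ) : ℂ) * Ψ (t * c)) = fun t => (fun s => ((χ (s * c⁻¹) : ℂˣ) : ℂ) * Ψ s) (t * c) := by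
      funext t
      simp only [mul_inv_cancel_right]
    rw [hsub, integral_mul_right_eq_self (fun s => ((χ (s * c⁻¹) : ℂˣ) : ℂ) * Ψ s) c]
    simp only [map_mul, Units.val_mul, hχc, mul_one]
    exact h
  · simp only [indicator_of_notMem hc, mul_zero, integral_zero]

/-- **Fourier uniqueness for continuous compactly supported functions.**  Let `T` be an abelian Hausdorff topological group in which every neighbourhood of `1`
contains a compact open subgroup (`hbasis`), `μ` a left-invariant s-finite measure, finite on compacta and positive on opens.  If `Ψ : T → ℂ` is continuous with
compact support and `∫ χ·Ψ dμ = 0` for every continuous, locally constant, unitary character `χ : T →* ℂˣ`, then `Ψ = 0`.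
[cite: HewittRoss1979, Thm. (23.11), Thm. (22.17)] [cite: Rogawski1990, §12.7 p. 193] -/
theorem eq_zero_of_continuous_of_forall_integral_char_mul_eq_zero [T2Space T] [SecondCountableTopology T]
    (μ : Measure T) [μ.IsMulLeftInvariant] [IsFiniteMeasureOnCompacts μ] [μ.IsOpenPosMeasure] [SFinite μ]
    (hbasis : ∀ U ∈ 𝓝 (1 : T), ∃ C : Subgroup T, IsOpen (C : Set T) ∧ IsCompact (C : Set T) ∧ (C : Set T) ⊆ U)
    (Ψ : T → ℂ) (hΨc : Continuous Ψ) (hK : HasCompactSupport Ψ)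
    (h : ∀ χ : T →* ℂˣ, Continuous χ → IsLocallyConstant χ → (∀ t, ‖((χ t : ℂˣ) : ℂ)‖ = 1) →
      ∫ t, ((χ t : ℂˣ) : ℂ) * Ψ t ∂μ = 0) :
    Ψ = 0 := by
  funext t₀
  rw [Pi.zero_apply]
  by_contra hne
  have hpos : 0 < ‖Ψ t₀‖ := norm_pos_iff.2 hne
  -- a neighbourhood of `1` on which `Ψ(t₀ ·)` moves by less than `‖Ψ t₀‖ / 2`, and a compact open subgroup inside it
  have hU : {c : T | ‖Ψ (t₀ * c) - Ψ t₀‖ < ‖Ψ t₀‖ / 2} ∈ 𝓝 (1 : T) := by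
    have hc : Continuous fun c : T => ‖Ψ (t₀ * c) - Ψ t₀‖ := ((hΨc.comp (continuous_const.mul continuous_id)).sub continuous_const).norm
    refine (hc.isOpen_preimage _ isOpen_Iio).mem_nhds ?_
    simp only [Set.mem_preimage, mul_one, sub_self, norm_zero, Set.mem_Iio]
    exact half_pos hpos
  obtain ⟨C, hCo, hCc, hCU⟩ := hbasis _ hU
  have hCm : MeasurableSet (C : Set T) := hCo.measurableSet
  -- the `C`-average vanishes identically, by ★ F3
  have hA : (fun t => ∫ c in (C : Set T), Ψ (t * c) ∂μ) = 0 := by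
    refine eq_of_forall_integral_char_mul_eq μ C hCo hCc (fun t => ∫ c in (C : Set T), Ψ (t * c) ∂μ) 0
      (fun t c hc => setIntegral_comp_mul_mul_eq μ C hCm Ψ t hc) (fun _ _ _ => rfl)
      (hasCompactSupport_setIntegral_comp_mul μ hCc Ψ hK) ?_ ?_
    · exact HasCompactSupport.zero
    · intro χ hχ hχlc hχC hχu
      simp only [Pi.zero_apply, mul_zero, integral_zero]
      exact integral_char_mul_setIntegral_comp_mul_eq_zero μ C hCo hCc Ψ hΨc hK χ hχ hχC (h χ hχ hχlc hχu)
  have hA0 : ∫ c in (C : Set T), Ψ (t₀ * c) ∂μ = 0 := congr_fun hA t₀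
  -- compare with `μ(C) • Ψ t₀`
  have hCfin : μ (C : Set T) < ⊤ := hCc.measure_lt_top
  have hCpos : 0 < μ.real (C : Set T) :=
    ENNReal.toReal_pos (hCo.measure_pos μ ⟨1, C.one_mem⟩).ne' hCfin.ne
  have hbound : ‖∫ c in (C : Set T), (Ψ (t₀ * c) - Ψ t₀) ∂μ‖ ≤ ‖Ψ t₀‖ / 2 * μ.real (C : Set T) :=
    norm_setIntegral_le_of_norm_le_const hCfin fun c hc => (hCU hc).le
  have hi1 : IntegrableOn (fun c => Ψ (t₀ * c)) (C : Set T) μ :=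
    (hΨc.comp (continuous_const.mul continuous_id)).continuousOn.integrableOn_compact hCc
  have hi2 : IntegrableOn (fun _ : T => Ψ t₀) (C : Set T) μ :=
    continuous_const.continuousOn.integrableOn_compact hCc
  rw [integral_sub hi1 hi2, hA0, zero_sub, norm_neg, setIntegral_const, norm_smul, Real.norm_eq_abs,
    abs_of_pos hCpos] at hbound
  nlinarith

end ContinuousUniq

end Literature.MeasureTheory.Group
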